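import Literature.AlgebraicGeometry.HodgeTheory.TopologicalChernWeilLineBridge
import Literature.AlgebraicGeometry.HodgeTheory.CartierCocycleChernCalculus
import Literature.AlgebraicGeometry.HodgeTheory.TopHodgeClassesSpannedByPullbacksOfInputs
import Literature.AlgebraicGeometry.HodgeTheory.ComplexTorusCartierDivisorChernCharacter
import Literature.AlgebraicGeometry.HodgeTheory.ComplexTorusNeronSeveriFormCupExpansion
import HarnessLib

/-!
# The topological Euler class of a hyperplane-section line bundle on a uniformised abelian variety, in the lattice cup frame

Family `hodge`, layer `Literature/AlgebraicGeometry/HodgeTheory`, namespace `Literature.AlgebraicGeometry.HodgeTheory`.  THEOREMS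
ONLY (no definition, no named fact, no instance).  Cell `hodgecm-mathlib` (D-0151), (U)-lane node U-e, (N3-core) «the polarisation
Gram is flat in a flat integral frame», per-fibre composite of the ASSEMBLER (P4 lead B-p03 (g14)): the three fibrewise engines are
composed ONCE on a single complex abelian variety, so that the family-level assembler only does transport.

For a complex abelian variety `A` uniformised by an additive analytification `φ : ℂ^g/Φ(ℤ^ι) → A(ℂ)` with the torus Hodge model OF
RECORD `B₀ = (E, E/Φ(ℤ^ι), φ, e₀)` (`E ≅ ℂ^g` the model space), `e₀` the complexified integration de Rham isomorphism ([Lange2023AbelianVarietiesComplex] §1.1.4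
Prop. 1.1.20), a closed immersion `ψ : A ⟶ ℙᴷ` (`dim A ≤ K`, `K ≥ 1`) with hyperplane divisor `D_ψ = (ψ^* x_j)`, a Hodge model `B` of
`ℙᴷ` together with (i) the ℙᴷ-line constant `μ ≠ 0` of ★ `exists_ne_zero_coreEulerClass_eq_smul_chernCharacter_projectiveSpace`
([MilnorStasheff1974] §14 Thm. 14.4: `e = c₁` on line bundles; [HatcherAT2002] Thm. 3.19: `H²(ℙᴷ(ℂ); ℂ)` is a line) and (ii) a
rigidity scalar `r ≠ 0` with `B₀.deRham = r • inducedIso B B₀` in degree `2` ([Kobayashi1987] Ch. II §1 Axiom 2 read across the two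
models; the cell feeds ONE `r` for all tori of the same model, ★ `exists_ne_zero_forall_torusModel_deRham_eq_smul_inducedIso`), an
Appell–Humbert datum `p′ = (H′, χ′)` of `𝒪_A(D_ψ)^an` and a frame `γ_a ∈ H¹(A(ℂ); ℚ)` lifting the canonical lattice classes
(`φ^* γ_a = ξ_a`):

  `e_ℂ(𝒪_A(-D_ψ)^top) = (μ r⁻¹) • ( ½ Σ_a Σ_b (E′(λ_a, λ_b) : ℚ) • γ_a ⌣ γ_b ) ⊗ 1`   in `H²(A(ℂ); ℂ)`,

`E′ = Im H′` in the lattice basis (`ComplexTorus.intGram`).  CHAIN (every link ★): the line bridge along `ψ` in its explicit-scalar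
form (★ `coreEulerClass_eq_smul_chernCharacter_pullback_of_deRham_eq_smul`, [HusemollerFibreBundles1994] Ch. 17 Prop. 3.3 +
[Kobayashi1987] Ch. II Thm. 2.16) ⟶ the pulled-back tautological cocycle is the tautological cocycle of `ψ`
(★ `tautologicalBundle_pullback_anMap`) ⟶ `ch₁(D_ψ) = -ch₁(𝒪(-1)|_A)` for a closed immersion (★
`HodgeModel.chernCharacter_cartierDivisorCocycle_divisor_eq_neg`, [GriffithsHarris1978] Ch. 1 §1 pp. 144–145) ⟶ `ch₁^{B₀}(𝒪_A(Θ)^an) =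
-(E₂⁻¹(E ⊗ 1)) ⊗ 1` EXACTLY for the model of record (★ `chernCharacter_cartierDivisorCocycle_hodgeModel_of_record`,
[Lange2023AbelianVarietiesComplex] §2.1.2 Lemma 2.1.2) ⟶ `E₂⁻¹(E ⊗ 1) = ½ Σ_a Σ_b E(λ_a,λ_b) γ_a ⌣ γ_b` (★
`bettiFormsEquivDeg_symm_ofRealForm_eq_sum_cupPowOne`, [Lange2023AbelianVarietiesComplex] §1.1.4 Prop. 1.1.20).  Main result:
`AbelianVariety.coreEulerClass_neg_hyperplaneDivisor_eq_smul_sum_intGram_cup`.  HC_CM is proved only modulo the 7 printed citations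
until rung 0 closes; this file discharges none.

## References
* [Lange2023AbelianVarietiesComplex] H. Lange, *Abelian Varieties over the Complex Numbers*, Springer 2023, §1.1.4 Prop. 1.1.20,
  §2.1.2 Lemma 2.1.2 and Thm. 2.1.3.
* [GriffithsHarris1978] P. Griffiths, J. Harris, *Principles of Algebraic Geometry*, Wiley 1978, Ch. 1 §1 pp. 144–145.
* [MilnorStasheff1974] J. Milnor, J. Stasheff, *Characteristic Classes*, Princeton 1974, §14 Thm. 14.4.
* [HatcherAT2002] A. Hatcher, *Algebraic Topology*, CUP 2002, Thm. 3.19, §3.2 Prop. 3.10.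
* [Kobayashi1987] S. Kobayashi, *Differential Geometry of Complex Vector Bundles*, Princeton 1987, Ch. II §1 Axiom 2, §2 Thm. 2.16.
* [HusemollerFibreBundles1994] D. Husemoller, *Fibre Bundles*, 3rd ed., Springer 1994, Ch. 17 Prop. 3.3.
-/

set_option autoImplicit false

noncomputable section

open CategoryTheory AlgebraicGeometry TopologicalSpace Opposite
open scoped Manifold ContDiff
open Literature.AlgebraicGeometry.Motives Literature.AlgebraicGeometry.Motives.AlgPoints
  Literature.AlgebraicGeometry.Motives.AnalytificationKaehler Literature.AlgebraicGeometry.Modules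
  Literature.AlgebraicTopology.CharacteristicClasses Literature.AlgebraicTopology.SingularHomology
  Literature.NumberTheory.Transcendental Literature.Geometry.Kaehler

namespace Literature.AlgebraicGeometry.HodgeTheory

section Fibre

variable {ι : Type} [Fintype ι] [DecidableEq ι] {E : Type} [NormedAddCommGroup E] [NormedSpace ℂ E]
  [FiniteDimensional ℝ E] [FiniteDimensional ℂ E] (A : AbelianVariety ℂ) (Φ : (ι → ℝ) ≃L[ℝ] E)
  (φ : C(ComplexTorus Φ, ComplexPoints A.X)) (hφ : IsAnalytification E A.X A.dim φ)
  {K : ℕ} (B : HodgeModel K (projectiveSpace K ℂ))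

/-- **`ch₁^{B₀}(𝒪(-1)|_A) = (½ Σ_a Σ_b E′_{ab} γ_a ⌣ γ_b) ⊗ 1` for the torus Hodge model of record** — Chern–Weil side of the chain:
★ `HodgeModel.chernCharacter_cartierDivisorCocycle_divisor_eq_neg` (closed immersion) + ★
`chernCharacter_cartierDivisorCocycle_hodgeModel_of_record` + ★ `bettiFormsEquivDeg_symm_ofRealForm_eq_sum_cupPowOne`.
[cite: Lange2023AbelianVarietiesComplex, §2.1.2 Lemma 2.1.2 and §1.1.4 Prop. 1.1.20] [cite: GriffithsHarris1978, Ch. 1 §1 pp. 144–145] -/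
theorem AbelianVariety.chernCharacter_tautologicalBundle_hodgeModel_of_record_eq_sum_intGram_cup
    (ψ : A.X ⟶ projectiveSpace K ℂ) [IsClosedImmersion ψ.left] (j : Fin (K + 1))
    (hj : genericPoint A.X.left ∈ (GeneratingSections.affineChartData ψ).U j)
    (p' : ComplexTorus.AHData Φ)
    (hp' : ComplexTorus.AHData.toPic p' =
      ComplexTorus.picClass (cartierDivisorLineBundle hφ ((GeneratingSections.affineChartData ψ).divisor j hj)))
    (γ : ι → singularCohomology ℚ ℚ (ComplexPoints A.X) 1)
    (hγ : ∀ a, singularCohomology.map ℚ ℚ φ 1 (γ a) = latticeClass Φ a) :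
    ({ model := E, carrier := ComplexTorus Φ, toComplexPoints := φ, isAnalytification := hφ,
        deRham := (integrationDeRhamIsoFamily E).complexify, deRham_isNatural := integrationFamily_isNatural,
        isInternal_hodgePQ := ComplexTorus.isInternal_hodgePQ Φ } : HodgeModel A.dim A.X).chernCharacter
        (tautologicalBundle ψ hφ) 1 =
      ofRatClass (ComplexPoints A.X) 2
        ((1 / 2 : ℚ) • ∑ a, ∑ b, ((ComplexTorus.intGram Φ p'.form a b : ℤ) : ℚ) •
          cupPowOne ℚ (ComplexPoints A.X) 2 ![γ a, γ b]) := by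
  set B₀ : HodgeModel A.dim A.X :=
    { model := E, carrier := ComplexTorus Φ, toComplexPoints := φ, isAnalytification := hφ,
      deRham := (integrationDeRhamIsoFamily E).complexify, deRham_isNatural := integrationFamily_isNatural,
      isInternal_hodgePQ := ComplexTorus.isInternal_hodgePQ Φ } with hB₀
  have hneg := B₀.chernCharacter_cartierDivisorCocycle_divisor_eq_neg ψ j hj
  have hrec := chernCharacter_cartierDivisorCocycle_hodgeModel_of_record Φ A φ hφ
    ((GeneratingSections.affineChartData ψ).divisor j hj) p' hp'
  have hδ := bettiFormsEquivDeg_symm_ofRealForm_eq_sum_cupPowOne Φ A φ hφ γ hγ p'.isNSForm_form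
  -- `ch₁(taut ψ) = -ch₁(D_ψ) = ofRatClass (E₂⁻¹ (E′ ⊗ 1))`
  have h1 : B₀.chernCharacter (tautologicalBundle ψ hφ) 1 =
      -B₀.chernCharacter (cartierDivisorCocycle hφ ((GeneratingSections.affineChartData ψ).divisor j hj)) 1 := by
    rw [hneg, neg_neg]
  rw [h1]
  change -(B₀.chernCharacter _ 1) = _
  rw [hrec, neg_neg]
  congr 1

variable [T2Space (ComplexPoints A.X)] [ParacompactSpace (ComplexPoints A.X)]
  [T2Space (ComplexPoints (projectiveSpace K ℂ))] [ParacompactSpace (ComplexPoints (projectiveSpace K ℂ))]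

/-- **THE PER-FIBRE COMPOSITE: `e_ℂ(𝒪_A(-D_ψ)^top) = (μ r⁻¹) • (½ Σ_a Σ_b E′_{ab} γ_a ⌣ γ_b) ⊗ 1`** on a uniformised complex abelian
variety `A` with its torus Hodge model of record `B₀`, for a closed immersion `ψ : A ⟶ ℙᴷ` (`dim A ≤ K`), a Hodge model `B` of
`ℙᴷ` with line constant `μ` and rigidity scalar `r ≠ 0` (`B₀.deRham = r • inducedIso B B₀` in degree `2`), an Appell–Humbert datum
`p′` of `𝒪_A(D_ψ)^an` and a frame `γ` lifting the canonical lattice classes. [cite: MilnorStasheff1974, §14 Thm. 14.4]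
[cite: Kobayashi1987, Ch. II §1 Axiom 2 and §2 Thm. 2.16] [cite: HusemollerFibreBundles1994, Ch. 17 Prop. 3.3]
[cite: Lange2023AbelianVarietiesComplex, §2.1.2 Lemma 2.1.2 and §1.1.4 Prop. 1.1.20] [cite: GriffithsHarris1978, Ch. 1 §1 pp. 144–145] -/
theorem AbelianVariety.coreEulerClass_neg_hyperplaneDivisor_eq_smul_sum_intGram_cup (hgK : A.dim ≤ K)
    {r : ℂ} (hr0 : r ≠ 0)
    (hr : ∀ y : complexDeRhamCohomology E (ComplexTorus Φ) (2 * 1),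
      ({ model := E, carrier := ComplexTorus Φ, toComplexPoints := φ, isAnalytification := hφ,
          deRham := (integrationDeRhamIsoFamily E).complexify, deRham_isNatural := integrationFamily_isNatural,
          isInternal_hodgePQ := ComplexTorus.isInternal_hodgePQ Φ } : HodgeModel A.dim A.X).deRham (ComplexTorus Φ) (2 * 1) y =
        r • HodgeModel.inducedIso B
          ({ model := E, carrier := ComplexTorus Φ, toComplexPoints := φ, isAnalytification := hφ,
              deRham := (integrationDeRhamIsoFamily E).complexify, deRham_isNatural := integrationFamily_isNatural,
              isInternal_hodgePQ := ComplexTorus.isInternal_hodgePQ Φ } : HodgeModel A.dim A.X) hgK (ComplexTorus Φ) (2 * 1) y)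
    (j₁ : Fin (K + 1))
    (hj₁ : genericPoint (projectiveSpace K ℂ).left ∈ (GeneratingSections.affineChartData (𝟙 (projectiveSpace K ℂ))).U j₁) {μ : ℂ}
    (hμ : eulerClass ℂ (-(GeneratingSections.affineChartData (𝟙 (projectiveSpace K ℂ))).divisor j₁ hj₁).toUnitCocycle.complexCore.Fiber
        (Module.finrank_self ℂ) ℂ 1 =
      μ • B.chernCharacter (tautologicalBundle (𝟙 (projectiveSpace K ℂ)) B.isAnalytification) 1)
    (ψ : A.X ⟶ projectiveSpace K ℂ) [IsClosedImmersion ψ.left] (j : Fin (K + 1))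
    (hj : genericPoint A.X.left ∈ (GeneratingSections.affineChartData ψ).U j)
    (p' : ComplexTorus.AHData Φ)
    (hp' : ComplexTorus.AHData.toPic p' =
      ComplexTorus.picClass (cartierDivisorLineBundle hφ ((GeneratingSections.affineChartData ψ).divisor j hj)))
    (γ : ι → singularCohomology ℚ ℚ (ComplexPoints A.X) 1)
    (hγ : ∀ a, singularCohomology.map ℚ ℚ φ 1 (γ a) = latticeClass Φ a) :
    eulerClass ℂ (-(GeneratingSections.affineChartData ψ).divisor j hj).toUnitCocycle.complexCore.Fiber (Module.finrank_self ℂ) ℂ 1 =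
      (μ * r⁻¹) • ofRatClass (ComplexPoints A.X) 2
        ((1 / 2 : ℚ) • ∑ a, ∑ b, ((ComplexTorus.intGram Φ p'.form a b : ℤ) : ℚ) •
          cupPowOne ℚ (ComplexPoints A.X) 2 ![γ a, γ b]) := by
  set B₀ : HodgeModel A.dim A.X :=
    { model := E, carrier := ComplexTorus Φ, toComplexPoints := φ, isAnalytification := hφ,
      deRham := (integrationDeRhamIsoFamily E).complexify, deRham_isNatural := integrationFamily_isNatural,
      isInternal_hodgePQ := ComplexTorus.isInternal_hodgePQ Φ } with hB₀
  have hA : IsSmoothProjective A.dim A.X := AbelianVariety.isSmoothProjective_holds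
  -- the line bridge along `ψ`, explicit scalar
  rw [coreEulerClass_eq_smul_chernCharacter_pullback_of_deRham_eq_smul hA B₀ B ψ j hj hgK hr0 hr j₁ hj₁ hμ]
  congr 1
  -- the pulled-back tautological cocycle is the tautological cocycle of `ψ = ψ ≫ 𝟙`
  haveI : IsClosedImmersion (ψ ≫ 𝟙 (projectiveSpace K ℂ)).left := by
    rw [Category.comp_id]; infer_instance
  have hpb := tautologicalBundle_pullback_anMap B₀ B ψ (𝟙 (projectiveSpace K ℂ)) hA (isSmoothProjective_projectiveSpace' K)
  rw [hpb]
  have hcomp : ∀ (χ : A.X ⟶ projectiveSpace K ℂ) [IsClosedImmersion χ.left] (h : χ = ψ),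
      B₀.chernCharacter (tautologicalBundle χ B₀.isAnalytification) 1 = B₀.chernCharacter (tautologicalBundle ψ hφ) 1 := by
    intro χ _ h
    subst h
    rfl
  rw [hcomp (ψ ≫ 𝟙 _) (Category.comp_id ψ)]
  exact AbelianVariety.chernCharacter_tautologicalBundle_hodgeModel_of_record_eq_sum_intGram_cup A Φ φ hφ ψ j hj p' hp' γ hγ

end Fibre

end Literature.AlgebraicGeometry.HodgeTheory

end
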